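import Mathlib
import HarnessLib

/-!
# Route `ColdStartUniversality` (fixed-cut-off SZZ dynamics; conjugation calculus, file 3):
# A MARTINGALE PROBLEM WITH VANISHING CARRÉ DU CHAMP HAS ABSOLUTELY CONTINUOUS PATHS

Helper file (seat `ym-line-csu-p1`, g23), abstract probability (no Yang–Mills objects).  Let `F, G` be bounded
processes adapted to a filtration `𝓕`, jointly measurable in `(time, ω)`, `G` with a.s. continuous paths, such that

* (D1) `E[Z (F_t − F_s)] = E[Z ∫_(s,t] G_r dr]` for all `s ≤ t` and every bounded `𝓕_s`-measurable `Z`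
  (Dynkin's formula for `F` with «generator value» `G`), and
* (D2) `E[F_t² − F_0²] = E[∫_(0,t] 2 F_r G_r dr]` (Dynkin's formula for `F²` with generator value `2FG`, i.e. the
  CARRÉ DU CHAMP of `F` VANISHES).

Then `F_t = F_0 + ∫_(0,t] G_r dr` almost surely, for every `t` (`ae_eq_add_integral_of_zero_carre`).  Proof (an
`L²` computation, [folklore]): with `A = F_t − F_0`, `B = ∫_(0,t] G`, `I = E ∫_(0,t] (F_r − F_0) G_r dr` one has
`E[A²] = 2I` ((D2) and (D1) with `Z = F_0`), `E[AB] = ½ E[B²] + I` (Fubini, (D1) with `Z = G_r`, and the triangle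
identity `∫_0^t G_r (∫_r^t G) dr = ½ (∫_0^t G)²`), hence `E[(A − B)²] = 0`.  If moreover `F` has a.s. continuous
paths, the identity holds a.s. SIMULTANEOUSLY for all `t` (`ae_forall_eq_add_integral_of_zero_carre`).

Used (sibling file) for the conjugated product `(ρU²)ᴴ ρU¹` of two SZZ solutions driven by the same noise.  THEOREMS
ONLY, no sorry.  HONEST FRAMING: abstract plumbing; nothing about Yang–Mills is proved; the mass gap is NOT proved.
-/

set_option autoImplicit false

noncomputable section

namespace Summit.QuantumFields.YangMills.Theorems.ColdStartUniversality

open MeasureTheory Filter Set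
open scoped NNReal Topology

/-! ## Deterministic lemmas -/

/-- **Triangle identity**: for continuous `g` and `a ≤ b`, `∫_(a,b] g(r) (∫_r^b g) dr = ½ (∫_(a,b] g)²` (FTC for
`Φ(r) = ∫_r^b g`). [folklore] -/
theorem integral_mul_integral_eq_half_sq {g : ℝ → ℝ} (hg : Continuous g) {a b : ℝ} (hab : a ≤ b) :
    ∫ r in Ioc a b, g r * (∫ u in r..b, g u) = (1 / 2) * (∫ r in Ioc a b, g r) ^ 2 := by
  set I : ℝ := ∫ x in a..b, g x with hI
  have hΦ : ∀ r, HasDerivAt (fun u => I - ∫ x in a..u, g x) (-g r) r := fun r => by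
    simpa using ((hg.integral_hasStrictDerivAt a r).hasDerivAt).const_sub I
  have hψ : ∀ r ∈ uIcc a b, HasDerivAt (fun u => -(1 / 2 : ℝ) * (I - ∫ x in a..u, g x) ^ 2)
      ((I - ∫ x in a..r, g x) * g r) r := by
    intro r _
    have h := ((hΦ r).pow 2).const_mul (-(1 / 2 : ℝ))
    refine h.congr_deriv ?_
    ring
  have hcontΦ : Continuous fun u => I - ∫ x in a..u, g x :=
    continuous_const.sub (intervalIntegral.continuous_primitive (fun _ _ => hg.intervalIntegrable _ _) a)
  have hint : IntervalIntegrable (fun r => (I - ∫ x in a..r, g x) * g r) volume a b :=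
    ((hcontΦ.mul hg).intervalIntegrable _ _)
  have hftc := intervalIntegral.integral_eq_sub_of_hasDerivAt hψ hint
  have hinner : ∀ r ∈ Ioc a b, (∫ u in r..b, g u) = I - ∫ x in a..r, g x := by
    intro r _
    rw [hI, eq_sub_iff_add_eq, add_comm,
      intervalIntegral.integral_add_adjacent_intervals (hg.intervalIntegrable _ _) (hg.intervalIntegrable _ _)]
  have hlhs : (∫ r in Ioc a b, g r * (∫ u in r..b, g u)) = ∫ r in Ioc a b, (I - ∫ x in a..r, g x) * g r := by
    refine setIntegral_congr_fun measurableSet_Ioc fun r hr => ?_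
    rw [hinner r hr, mul_comm]
  rw [hlhs, ← intervalIntegral.integral_of_le hab, hftc, ← intervalIntegral.integral_of_le hab]
  simp only [intervalIntegral.integral_same, sub_zero, ← hI, sub_self]
  ring

/-- The interval integral `r ↦ ∫_r^b g` of a bounded measurable `g` is continuous. [folklore] -/
theorem continuous_intervalIntegral_left {g : ℝ → ℝ} (hg : Measurable g) {C : ℝ} (hC : ∀ r, |g r| ≤ C) (b : ℝ) :
    Continuous fun r => ∫ u in r..b, g u := by
  have hii : ∀ a a' : ℝ, IntervalIntegrable g volume a a' := fun a a' =>
    (intervalIntegrable_const (c := C)).mono_fun' hg.aestronglyMeasurable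
      (Eventually.of_forall fun r => (Real.norm_eq_abs _).le.trans (hC r))
  have h := intervalIntegral.continuous_primitive hii b
  have heq : (fun r => ∫ u in r..b, g u) = fun r => -∫ u in b..r, g u := by
    funext r; rw [intervalIntegral.integral_symm]
  rw [heq]
  exact h.neg

section Abstract

variable {Ω : Type*} {mΩ : MeasurableSpace Ω} {P : Measure Ω} [IsProbabilityMeasure P]

/-- A bounded jointly measurable integrand on `Ω × (s,t]` is integrable for the product measure. [folklore] -/
theorem integrable_prod_Ioc_of_bound {h : Ω → ℝ → ℝ} (hm : Measurable fun p : Ω × ℝ => h p.1 p.2) {C : ℝ}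
    (hC : ∀ ω r, |h ω r| ≤ C) (s t : ℝ) :
    Integrable (Function.uncurry h) (P.prod (volume.restrict (Ioc s t))) := by
  haveI : IsFiniteMeasure (volume.restrict (Ioc s t) : Measure ℝ) := ⟨by simp [Real.volume_Ioc]⟩
  refine Integrable.of_bound hm.aestronglyMeasurable C (Eventually.of_forall fun p => ?_)
  simpa [Function.uncurry, Real.norm_eq_abs] using hC p.1 p.2

/-- **Fubini for bounded jointly measurable integrands on `Ω × (s,t]`.** [folklore] -/
theorem integral_integral_Ioc_swap {h : Ω → ℝ → ℝ} (hm : Measurable fun p : Ω × ℝ => h p.1 p.2) {C : ℝ}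
    (hC : ∀ ω r, |h ω r| ≤ C) (s t : ℝ) :
    ∫ ω, (∫ r in Ioc s t, h ω r) ∂P = ∫ r in Ioc s t, (∫ ω, h ω r ∂P) :=
  integral_integral_swap (integrable_prod_Ioc_of_bound hm hC s t)

/-- The `ω`-section `ω ↦ ∫_(s,t] h(ω, r) dr` of a bounded jointly measurable integrand is measurable and bounded by
`C (t - s)` (`s ≤ t`). [folklore] -/
theorem measurable_integral_Ioc {h : Ω → ℝ → ℝ} (hm : Measurable fun p : Ω × ℝ => h p.1 p.2) (s t : ℝ) :
    Measurable fun ω => ∫ r in Ioc s t, h ω r :=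
  (StronglyMeasurable.integral_prod_right (ν := volume.restrict (Ioc s t))
    (hm.stronglyMeasurable : StronglyMeasurable (Function.uncurry h))).measurable

/-- Bound on the section integral. [folklore] -/
theorem abs_integral_Ioc_le {h : Ω → ℝ → ℝ} {C : ℝ} (hC : ∀ ω r, |h ω r| ≤ C) {s t : ℝ} (hst : s ≤ t) (ω : Ω) :
    |∫ r in Ioc s t, h ω r| ≤ C * (t - s) := by
  calc |∫ r in Ioc s t, h ω r| ≤ ∫ r in Ioc s t, |h ω r| := abs_integral_le_integral_abs
    _ ≤ ∫ r in Ioc s t, C := by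
        refine integral_mono_of_nonneg (Eventually.of_forall fun _ => abs_nonneg _) ?_
          (Eventually.of_forall fun r => hC ω r)
        haveI : IsFiniteMeasure (volume.restrict (Ioc s t) : Measure ℝ) := ⟨by simp [Real.volume_Ioc]⟩
        exact integrable_const _
    _ = C * (t - s) := by
        rw [setIntegral_const, Real.volume_real_Ioc_of_le hst, smul_eq_mul, mul_comm]

/-- **Joint measurability of the tail integral** `(ω, r) ↦ ∫_r^t g(ω, u) du` of a bounded jointly measurable `g`
(continuous in `r`, measurable in `ω`). [folklore] -/
theorem measurable_intervalIntegral_param {g : Ω → ℝ → ℝ} (hm : Measurable fun p : Ω × ℝ => g p.1 p.2) {C : ℝ}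
    (hC : ∀ ω r, |g ω r| ≤ C) (t : ℝ) :
    Measurable fun p : Ω × ℝ => ∫ u in p.2..t, g p.1 u := by
  have hsec : ∀ ω, Measurable fun r => g ω r := fun ω => hm.comp measurable_prodMk_left
  have hu : Measurable (Function.uncurry fun (r : ℝ) (ω : Ω) => ∫ u in r..t, g ω u) := by
    refine measurable_uncurry_of_continuous_of_measurable (fun ω => ?_) (fun r => ?_)
    · exact continuous_intervalIntegral_left (hsec ω) (fun r => hC ω r) t
    · simp only [intervalIntegral]
      exact (measurable_integral_Ioc hm r t).sub (measurable_integral_Ioc hm t r)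
  exact hu.comp (measurable_snd.prodMk measurable_fst)

variable {𝓕 : Filtration ℝ≥0 mΩ} {F G : ℝ≥0 → Ω → ℝ} {CF CG : ℝ}

/-- ★ **A martingale problem with vanishing carré du champ has absolutely continuous paths.**  (D1) for `F` with
generator value `G`, (D2) for `F²` with generator value `2FG`, bounded adapted jointly measurable `F, G`, a.s.
continuous paths of `G` ⟹ `F_t = F_0 + ∫_(0,t] G` a.s., for each `t`. [folklore] -/
theorem ae_eq_add_integral_of_zero_carre
    (hFb : ∀ t ω, |F t ω| ≤ CF) (hGb : ∀ t ω, |G t ω| ≤ CG)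
    (hFad : ∀ t, StronglyMeasurable[𝓕 t] (F t)) (hGad : ∀ t, StronglyMeasurable[𝓕 t] (G t))
    (hFm : Measurable fun p : Ω × ℝ => F p.2.toNNReal p.1) (hGm : Measurable fun p : Ω × ℝ => G p.2.toNNReal p.1)
    (hGc : ∀ᵐ ω ∂P, Continuous fun r : ℝ => G r.toNNReal ω)
    (hD1 : ∀ (s t : ℝ≥0), s ≤ t → ∀ (Z : Ω → ℝ) (C : ℝ), StronglyMeasurable[𝓕 s] Z → (∀ ω, |Z ω| ≤ C) →
      ∫ ω, Z ω * (F t ω - F s ω) ∂P = ∫ ω, Z ω * (∫ r in Ioc (s : ℝ) t, G r.toNNReal ω) ∂P)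
    (hD2 : ∀ t : ℝ≥0, ∫ ω, (F t ω ^ 2 - F 0 ω ^ 2) ∂P =
      ∫ ω, (∫ r in Ioc (0 : ℝ) t, 2 * F r.toNNReal ω * G r.toNNReal ω) ∂P)
    (t : ℝ≥0) :
    ∀ᵐ ω ∂P, F t ω = F 0 ω + ∫ r in Ioc (0 : ℝ) t, G r.toNNReal ω := by
  obtain ⟨ω₀⟩ := nonempty_of_isProbabilityMeasure P
  have hCF : 0 ≤ CF := (abs_nonneg _).trans (hFb 0 ω₀)
  have hCG : 0 ≤ CG := (abs_nonneg _).trans (hGb 0 ω₀)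
  have ht0 : (0 : ℝ) ≤ t := t.coe_nonneg
  -- measurability bookkeeping
  have hFmeas : ∀ s : ℝ≥0, Measurable (F s) := fun s => ((hFad s).measurable).mono (𝓕.le s) le_rfl
  have hGmeas : ∀ s : ℝ≥0, Measurable (G s) := fun s => ((hGad s).measurable).mono (𝓕.le s) le_rfl
  have hGsec : ∀ ω, Measurable fun r : ℝ => G r.toNNReal ω := fun ω => hGm.comp measurable_prodMk_left
  have hFsec : ∀ ω, Measurable fun r : ℝ => F r.toNNReal ω := fun ω => hFm.comp measurable_prodMk_left
  -- bounded measurable functions on `Ω` are integrable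
  have hIntΩ : ∀ {f : Ω → ℝ} (C : ℝ), Measurable f → (∀ ω, |f ω| ≤ C) → Integrable f P := fun C hf hb =>
    Integrable.of_bound hf.aestronglyMeasurable C (Eventually.of_forall fun ω => by rw [Real.norm_eq_abs]; exact hb ω)
  haveI hfin : IsFiniteMeasure (volume.restrict (Ioc (0 : ℝ) t) : Measure ℝ) := ⟨by simp [Real.volume_Ioc]⟩
  have hIntR : ∀ {f : ℝ → ℝ} (C : ℝ), Measurable f → (∀ r, |f r| ≤ C) →
      Integrable f (volume.restrict (Ioc (0 : ℝ) t)) := fun C hf hb =>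
    Integrable.of_bound hf.aestronglyMeasurable C (Eventually.of_forall fun r => by rw [Real.norm_eq_abs]; exact hb r)
  -- the objects `A`, `B`, `Φ`, `I`
  set B : Ω → ℝ := fun ω => ∫ r in Ioc (0 : ℝ) t, G r.toNNReal ω with hB
  have hBm : Measurable B := measurable_integral_Ioc (h := fun ω r => G r.toNNReal ω) hGm 0 t
  have hBbd : ∀ ω, |B ω| ≤ CG * t := fun ω => by
    simpa using abs_integral_Ioc_le (h := fun ω r => G r.toNNReal ω) (fun ω r => hGb _ ω) ht0 ω
  set Φ : Ω → ℝ → ℝ := fun ω r => ∫ u in r..(t : ℝ), G u.toNNReal ω with hΦ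
  have hΦm : Measurable fun p : Ω × ℝ => Φ p.1 p.2 :=
    measurable_intervalIntegral_param (g := fun ω u => G u.toNNReal ω) hGm (fun ω r => hGb _ ω) t
  have hΦIoc : ∀ ω, ∀ r ∈ Ioc (0 : ℝ) t, Φ ω r = ∫ u in Ioc r t, G u.toNNReal ω := fun ω r hr => by
    simp only [hΦ]; rw [intervalIntegral.integral_of_le hr.2]
  have hΦbd : ∀ ω r, r ∈ Ioc (0 : ℝ) t → |Φ ω r| ≤ CG * t := by
    intro ω r hr
    rw [hΦIoc ω r hr]
    have h := abs_integral_Ioc_le (h := fun ω u => G u.toNNReal ω) (fun ω u => hGb _ ω) hr.2 ω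
    have : CG * ((t : ℝ) - r) ≤ CG * t := mul_le_mul_of_nonneg_left (by linarith [hr.1]) hCG
    exact h.trans this
  -- truncate `Φ` outside `(0,t]` to keep a global bound (values inside are unchanged)
  set Φ' : Ω → ℝ → ℝ := fun ω r => Set.indicator (Ioc (0 : ℝ) t) (Φ ω) r with hΦ'
  have hΦ'm : Measurable fun p : Ω × ℝ => Φ' p.1 p.2 := by
    have : (fun p : Ω × ℝ => Φ' p.1 p.2) = Set.indicator {p : Ω × ℝ | p.2 ∈ Ioc (0 : ℝ) t} fun p => Φ p.1 p.2 := by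
      funext p; simp only [hΦ', Set.indicator_apply, Set.mem_setOf_eq]
    rw [this]
    exact hΦm.indicator (measurableSet_Ioc.preimage measurable_snd)
  have hΦ'bd : ∀ ω r, |Φ' ω r| ≤ CG * t := by
    intro ω r
    simp only [hΦ', Set.indicator_apply]
    split_ifs with hr
    · exact hΦbd ω r hr
    · simp only [abs_zero]; positivity
  have hΦ'eq : ∀ ω, ∀ r ∈ Ioc (0 : ℝ) t, Φ' ω r = ∫ u in Ioc r t, G u.toNNReal ω := fun ω r hr => by
    simp only [hΦ', Set.indicator_of_mem hr]; exact hΦIoc ω r hr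
  set I : ℝ := ∫ ω, (∫ r in Ioc (0 : ℝ) t, (F r.toNNReal ω - F 0 ω) * G r.toNNReal ω) ∂P with hI
  -- integrand bounds used repeatedly
  have hbdFG : ∀ ω (r : ℝ), |(F r.toNNReal ω - F 0 ω) * G r.toNNReal ω| ≤ (CF + CF) * CG := fun ω r => by
    rw [abs_mul]
    exact mul_le_mul ((abs_sub _ _).trans (add_le_add (hFb _ _) (hFb _ _))) (hGb _ _) (abs_nonneg _) (by positivity)
  have hmFG : Measurable fun p : Ω × ℝ => (F p.2.toNNReal p.1 - F 0 p.1) * G p.2.toNNReal p.1 :=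
    (hFm.sub ((hFmeas 0).comp measurable_fst)).mul hGm
  -- (1) `E[(F_t - F_0)²] = 2 I`
  have hA2 : ∫ ω, (F t ω - F 0 ω) ^ 2 ∂P = 2 * I := by
    have h0 := hD1 0 t bot_le (F 0) CF (hFad 0) (hFb 0)
    simp only [NNReal.coe_zero] at h0
    have hsq : ∀ ω, (F t ω - F 0 ω) ^ 2 = (F t ω ^ 2 - F 0 ω ^ 2) - 2 * (F 0 ω * (F t ω - F 0 ω)) := fun ω => by
      ring
    simp_rw [hsq]
    have hi1 : Integrable (fun ω => F t ω ^ 2 - F 0 ω ^ 2) P := by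
      refine hIntΩ (CF ^ 2 + CF ^ 2) (((hFmeas t).pow_const 2).sub ((hFmeas 0).pow_const 2)) fun ω => ?_
      have h1 : |F t ω| ^ 2 ≤ CF ^ 2 := pow_le_pow_left₀ (abs_nonneg _) (hFb t ω) 2
      have h2 : |F 0 ω| ^ 2 ≤ CF ^ 2 := pow_le_pow_left₀ (abs_nonneg _) (hFb 0 ω) 2
      calc |F t ω ^ 2 - F 0 ω ^ 2| ≤ |F t ω ^ 2| + |F 0 ω ^ 2| := abs_sub _ _
        _ = |F t ω| ^ 2 + |F 0 ω| ^ 2 := by rw [abs_pow, abs_pow]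
        _ ≤ CF ^ 2 + CF ^ 2 := add_le_add h1 h2
    have hi2 : Integrable (fun ω => F 0 ω * (F t ω - F 0 ω)) P := by
      refine hIntΩ (CF * (CF + CF)) ((hFmeas 0).mul ((hFmeas t).sub (hFmeas 0))) fun ω => ?_
      rw [abs_mul]
      exact mul_le_mul (hFb 0 ω) ((abs_sub _ _).trans (add_le_add (hFb t ω) (hFb 0 ω))) (abs_nonneg _) hCF
    rw [integral_sub hi1 (hi2.const_mul 2), integral_const_mul, hD2 t, h0]
    have hm2 : Measurable fun p : Ω × ℝ => 2 * F p.2.toNNReal p.1 * G p.2.toNNReal p.1 := (hFm.const_mul 2).mul hGm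
    have hbd2 : ∀ ω (r : ℝ), |2 * F r.toNNReal ω * G r.toNNReal ω| ≤ 2 * CF * CG := fun ω r => by
      rw [abs_mul, abs_mul, abs_two]
      exact mul_le_mul (mul_le_mul_of_nonneg_left (hFb _ _) zero_le_two) (hGb _ _) (abs_nonneg _) (by positivity)
    have hi3 : Integrable (fun ω => ∫ r in Ioc (0 : ℝ) t, 2 * F r.toNNReal ω * G r.toNNReal ω) P := by
      refine hIntΩ (2 * CF * CG * t) (measurable_integral_Ioc (h := fun ω r => 2 * F r.toNNReal ω * G r.toNNReal ω)
        hm2 0 t) fun ω => ?_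
      simpa using abs_integral_Ioc_le (h := fun ω r => 2 * F r.toNNReal ω * G r.toNNReal ω) hbd2 ht0 ω
    have hi4 : Integrable (fun ω => F 0 ω * B ω) P := by
      refine hIntΩ (CF * (CG * t)) ((hFmeas 0).mul hBm) fun ω => ?_
      rw [abs_mul]; exact mul_le_mul (hFb 0 ω) (hBbd ω) (abs_nonneg _) hCF
    rw [← integral_const_mul, ← integral_sub hi3 (hi4.const_mul 2), hI, ← integral_const_mul]
    refine integral_congr_ae (Eventually.of_forall fun ω => ?_)
    have hiF : Integrable (fun r : ℝ => 2 * F r.toNNReal ω * G r.toNNReal ω) (volume.restrict (Ioc (0 : ℝ) t)) :=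
      hIntR (2 * CF * CG) (((hFsec ω).const_mul 2).mul (hGsec ω)) fun r => hbd2 ω r
    have hiG : Integrable (fun r : ℝ => 2 * F 0 ω * G r.toNNReal ω) (volume.restrict (Ioc (0 : ℝ) t)) :=
      hIntR (2 * CF * CG) ((hGsec ω).const_mul _) fun r => by
        rw [abs_mul, abs_mul, abs_two]
        exact mul_le_mul (mul_le_mul_of_nonneg_left (hFb _ _) zero_le_two) (hGb _ _) (abs_nonneg _) (by positivity)
    simp only [hB]
    have e1 : (2 : ℝ) * (F 0 ω * ∫ r in Ioc (0 : ℝ) t, G r.toNNReal ω) =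
        ∫ r in Ioc (0 : ℝ) t, 2 * F 0 ω * G r.toNNReal ω := by
      rw [← integral_const_mul, ← integral_const_mul]
      exact integral_congr_ae (Eventually.of_forall fun r => by ring)
    rw [e1, ← integral_sub hiF hiG, ← integral_const_mul]
    exact integral_congr_ae (Eventually.of_forall fun r => by ring)
  -- (2) `E[(F_t - F_0) B] = ½ E[B²] + I`
  have hAB : ∫ ω, (F t ω - F 0 ω) * B ω ∂P = (1 / 2) * ∫ ω, B ω ^ 2 ∂P + I := by
    -- Fubini #1
    have hm1 : Measurable fun p : Ω × ℝ => (F t p.1 - F 0 p.1) * G p.2.toNNReal p.1 :=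
      (((hFmeas t).comp measurable_fst).sub ((hFmeas 0).comp measurable_fst)).mul hGm
    have hbd1 : ∀ ω (r : ℝ), |(F t ω - F 0 ω) * G r.toNNReal ω| ≤ (CF + CF) * CG := fun ω r => by
      rw [abs_mul]
      exact mul_le_mul ((abs_sub _ _).trans (add_le_add (hFb t ω) (hFb 0 ω))) (hGb _ _) (abs_nonneg _)
        (by positivity)
    have hstep1 : ∫ ω, (F t ω - F 0 ω) * B ω ∂P = ∫ r in Ioc (0 : ℝ) t, (∫ ω, (F t ω - F 0 ω) * G r.toNNReal ω ∂P) := by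
      rw [← integral_integral_Ioc_swap (h := fun ω r => (F t ω - F 0 ω) * G r.toNNReal ω) hm1 hbd1 0 t]
      refine integral_congr_ae (Eventually.of_forall fun ω => ?_)
      simp only [hB]
      rw [← integral_const_mul]
    -- (D1) with `Z = G_r` at each `r ∈ (0,t]`
    have hstep2 : ∀ r ∈ Ioc (0 : ℝ) t, ∫ ω, (F t ω - F 0 ω) * G r.toNNReal ω ∂P =
        ∫ ω, G r.toNNReal ω * Φ' ω r ∂P + ∫ ω, (F r.toNNReal ω - F 0 ω) * G r.toNNReal ω ∂P := by
      intro r hr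
      have hrt : r.toNNReal ≤ t := by
        rw [← NNReal.coe_le_coe, Real.coe_toNNReal _ hr.1.le]; exact hr.2
      have h := hD1 r.toNNReal t hrt (G r.toNNReal) CG (hGad _) (hGb _)
      rw [Real.coe_toNNReal _ hr.1.le] at h
      have hi1 : Integrable (fun ω => G r.toNNReal ω * (F t ω - F r.toNNReal ω)) P := by
        refine hIntΩ (CG * (CF + CF)) ((hGmeas _).mul ((hFmeas t).sub (hFmeas _))) fun ω => ?_
        rw [abs_mul]
        exact mul_le_mul (hGb _ _) ((abs_sub _ _).trans (add_le_add (hFb _ _) (hFb _ _))) (abs_nonneg _) hCG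
      have hi2 : Integrable (fun ω => (F r.toNNReal ω - F 0 ω) * G r.toNNReal ω) P :=
        hIntΩ ((CF + CF) * CG) (((hFmeas _).sub (hFmeas 0)).mul (hGmeas _)) fun ω => hbdFG ω r
      have heq : (fun ω => G r.toNNReal ω * Φ' ω r) = fun ω => G r.toNNReal ω * ∫ u in Ioc r t, G u.toNNReal ω := by
        funext ω; rw [hΦ'eq ω r hr]
      rw [heq, ← h, ← integral_add hi1 hi2]
      exact integral_congr_ae (Eventually.of_forall fun ω => by ring)
    have hstep3 : (∫ r in Ioc (0 : ℝ) t, (∫ ω, (F t ω - F 0 ω) * G r.toNNReal ω ∂P)) =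
        (∫ r in Ioc (0 : ℝ) t, ∫ ω, G r.toNNReal ω * Φ' ω r ∂P) +
          ∫ r in Ioc (0 : ℝ) t, ∫ ω, (F r.toNNReal ω - F 0 ω) * G r.toNNReal ω ∂P := by
      rw [setIntegral_congr_fun measurableSet_Ioc hstep2, integral_add]
      · -- integrability in `r` of `r ↦ E[G_r Φ'_r]`
        have hm : Measurable fun p : Ω × ℝ => G p.2.toNNReal p.1 * Φ' p.1 p.2 := hGm.mul hΦ'm
        refine hIntR (CG * (CG * t)) ?_ fun r => ?_
        · exact ((hm.stronglyMeasurable : StronglyMeasurable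
            (Function.uncurry fun (ω : Ω) (r : ℝ) => G r.toNNReal ω * Φ' ω r)).integral_prod_left (μ := P)).measurable
        · calc |∫ ω, G r.toNNReal ω * Φ' ω r ∂P| ≤ ∫ ω, |G r.toNNReal ω * Φ' ω r| ∂P := abs_integral_le_integral_abs
            _ ≤ ∫ _ω, CG * (CG * t) ∂P := by
                refine integral_mono_of_nonneg (Eventually.of_forall fun _ => abs_nonneg _) (integrable_const _)
                  (Eventually.of_forall fun ω => ?_)
                dsimp only
                rw [abs_mul]; exact mul_le_mul (hGb _ _) (hΦ'bd ω r) (abs_nonneg _) hCG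
            _ = CG * (CG * t) := by simp
      · have hm : Measurable fun p : Ω × ℝ => (F p.2.toNNReal p.1 - F 0 p.1) * G p.2.toNNReal p.1 := hmFG
        refine hIntR ((CF + CF) * CG) ?_ fun r => ?_
        · exact ((hm.stronglyMeasurable : StronglyMeasurable
            (Function.uncurry fun (ω : Ω) (r : ℝ) => (F r.toNNReal ω - F 0 ω) * G r.toNNReal ω)).integral_prod_left
              (μ := P)).measurable
        · calc |∫ ω, (F r.toNNReal ω - F 0 ω) * G r.toNNReal ω ∂P|
              ≤ ∫ ω, |(F r.toNNReal ω - F 0 ω) * G r.toNNReal ω| ∂P := abs_integral_le_integral_abs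
            _ ≤ ∫ _ω, (CF + CF) * CG ∂P :=
                integral_mono_of_nonneg (Eventually.of_forall fun _ => abs_nonneg _) (integrable_const _)
                  (Eventually.of_forall fun ω => hbdFG ω r)
            _ = (CF + CF) * CG := by simp
    -- Fubini #2 and #3 (back to `ω`-integrals)
    have hstep4 : (∫ r in Ioc (0 : ℝ) t, ∫ ω, G r.toNNReal ω * Φ' ω r ∂P) =
        ∫ ω, (∫ r in Ioc (0 : ℝ) t, G r.toNNReal ω * Φ' ω r) ∂P :=
      (integral_integral_Ioc_swap (h := fun ω r => G r.toNNReal ω * Φ' ω r) (hGm.mul hΦ'm)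
        (C := CG * (CG * t)) (fun ω r => by
          rw [abs_mul]; exact mul_le_mul (hGb _ _) (hΦ'bd ω r) (abs_nonneg _) hCG) 0 t).symm
    have hstep5 : (∫ r in Ioc (0 : ℝ) t, ∫ ω, (F r.toNNReal ω - F 0 ω) * G r.toNNReal ω ∂P) = I :=
      (integral_integral_Ioc_swap (h := fun ω r => (F r.toNNReal ω - F 0 ω) * G r.toNNReal ω) hmFG hbdFG 0 t).symm
    -- the pathwise triangle identity `∫ G_r Φ_r dr = ½ B²` along continuous paths
    have hstep6 : ∫ ω, (∫ r in Ioc (0 : ℝ) t, G r.toNNReal ω * Φ' ω r) ∂P = (1 / 2) * ∫ ω, B ω ^ 2 ∂P := by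
      rw [← integral_const_mul]
      refine integral_congr_ae ?_
      filter_upwards [hGc] with ω hω
      have h := integral_mul_integral_eq_half_sq hω ht0
      rw [← h]
      refine setIntegral_congr_fun measurableSet_Ioc fun r hr => ?_
      rw [hΦ'eq ω r hr, intervalIntegral.integral_of_le hr.2]
    rw [hstep1, hstep3, hstep4, hstep5, hstep6]
  -- (3) `E[(A - B)²] = 0`, hence `A = B` a.s.
  have hAm : Measurable fun ω => F t ω - F 0 ω := (hFmeas t).sub (hFmeas 0)
  have hAbd : ∀ ω, |F t ω - F 0 ω| ≤ CF + CF := fun ω => (abs_sub _ _).trans (add_le_add (hFb t ω) (hFb 0 ω))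
  have hiA2 : Integrable (fun ω => (F t ω - F 0 ω) ^ 2) P :=
    hIntΩ ((CF + CF) ^ 2) (hAm.pow_const 2) fun ω => by
      rw [abs_pow]; exact pow_le_pow_left₀ (abs_nonneg _) (hAbd ω) 2
  have hiB2 : Integrable (fun ω => B ω ^ 2) P :=
    hIntΩ ((CG * t) ^ 2) (hBm.pow_const 2) fun ω => by
      rw [abs_pow]; exact pow_le_pow_left₀ (abs_nonneg _) (hBbd ω) 2
  have hiAB : Integrable (fun ω => (F t ω - F 0 ω) * B ω) P :=
    hIntΩ ((CF + CF) * (CG * t)) (hAm.mul hBm) fun ω => by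
      rw [abs_mul]; exact mul_le_mul (hAbd ω) (hBbd ω) (abs_nonneg _) (by positivity)
  have hzero : ∫ ω, (F t ω - F 0 ω - B ω) ^ 2 ∂P = 0 := by
    have hfun : (fun ω => (F t ω - F 0 ω - B ω) ^ 2) =
        ((fun ω => (F t ω - F 0 ω) ^ 2) - fun ω => 2 * ((F t ω - F 0 ω) * B ω)) + fun ω => B ω ^ 2 := by
      funext ω; simp only [Pi.add_apply, Pi.sub_apply]; ring
    rw [hfun, integral_add' (hiA2.sub (hiAB.const_mul 2)) hiB2, integral_sub' hiA2 (hiAB.const_mul 2),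
      integral_const_mul, hA2, hAB]
    ring
  have hnonneg : 0 ≤ᵐ[P] fun ω => (F t ω - F 0 ω - B ω) ^ 2 := Eventually.of_forall fun ω => sq_nonneg _
  have hiD : Integrable (fun ω => (F t ω - F 0 ω - B ω) ^ 2) P :=
    hIntΩ ((CF + CF + CG * t) ^ 2) ((hAm.sub hBm).pow_const 2) fun ω => by
      rw [abs_pow]
      refine pow_le_pow_left₀ (abs_nonneg _) ((abs_sub _ _).trans (add_le_add (hAbd ω) (hBbd ω))) 2
  have hae := (integral_eq_zero_iff_of_nonneg_ae hnonneg hiD).1 hzero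
  filter_upwards [hae] with ω hω
  have h0 : (F t ω - F 0 ω - B ω) ^ 2 = 0 := by simpa using hω
  have h1 : F t ω - F 0 ω - B ω = 0 := (pow_eq_zero_iff two_ne_zero).1 h0
  simp only [hB] at h1; linarith

/-- ★ **All times simultaneously**: if moreover `F` has a.s. continuous paths, then almost surely
`F_t = F_0 + ∫_(0,t] G` for ALL `t ≥ 0`. [folklore] -/
theorem ae_forall_eq_add_integral_of_zero_carre
    (hFb : ∀ t ω, |F t ω| ≤ CF) (hGb : ∀ t ω, |G t ω| ≤ CG)
    (hFad : ∀ t, StronglyMeasurable[𝓕 t] (F t)) (hGad : ∀ t, StronglyMeasurable[𝓕 t] (G t))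
    (hFm : Measurable fun p : Ω × ℝ => F p.2.toNNReal p.1) (hGm : Measurable fun p : Ω × ℝ => G p.2.toNNReal p.1)
    (hFc : ∀ᵐ ω ∂P, Continuous fun r : ℝ≥0 => F r ω) (hGc : ∀ᵐ ω ∂P, Continuous fun r : ℝ => G r.toNNReal ω)
    (hD1 : ∀ (s t : ℝ≥0), s ≤ t → ∀ (Z : Ω → ℝ) (C : ℝ), StronglyMeasurable[𝓕 s] Z → (∀ ω, |Z ω| ≤ C) →
      ∫ ω, Z ω * (F t ω - F s ω) ∂P = ∫ ω, Z ω * (∫ r in Ioc (s : ℝ) t, G r.toNNReal ω) ∂P)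
    (hD2 : ∀ t : ℝ≥0, ∫ ω, (F t ω ^ 2 - F 0 ω ^ 2) ∂P =
      ∫ ω, (∫ r in Ioc (0 : ℝ) t, 2 * F r.toNNReal ω * G r.toNNReal ω) ∂P) :
    ∀ᵐ ω ∂P, ∀ t : ℝ≥0, F t ω = F 0 ω + ∫ r in Ioc (0 : ℝ) t, G r.toNNReal ω := by
  -- the identity at all nonnegative rational times
  have hq : ∀ᵐ ω ∂P, ∀ q : ℚ, F (Real.toNNReal q) ω = F 0 ω + ∫ r in Ioc (0 : ℝ) (Real.toNNReal q), G r.toNNReal ω :=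
    ae_all_iff.2 fun q => ae_eq_add_integral_of_zero_carre hFb hGb hFad hGad hFm hGm hGc hD1 hD2 (Real.toNNReal q)
  have hGsec : ∀ ω, Measurable fun r : ℝ => G r.toNNReal ω := fun ω => hGm.comp measurable_prodMk_left
  filter_upwards [hq, hFc] with ω hω hωc t
  -- both sides are continuous in `t`; they agree on the dense set of rational times
  have hR : Continuous fun s : ℝ≥0 => F 0 ω + ∫ r in Ioc (0 : ℝ) s, G r.toNNReal ω := by
    have hii : ∀ a b : ℝ, IntervalIntegrable (fun r : ℝ => G r.toNNReal ω) volume a b := fun a b =>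
      (intervalIntegrable_const (c := CG)).mono_fun' (hGsec ω).aestronglyMeasurable
        (Eventually.of_forall fun r => (Real.norm_eq_abs _).le.trans (hGb _ ω))
    have hprim := intervalIntegral.continuous_primitive hii 0
    have heq : (fun s : ℝ≥0 => F 0 ω + ∫ r in Ioc (0 : ℝ) s, G r.toNNReal ω) =
        fun s : ℝ≥0 => F 0 ω + ∫ r in (0 : ℝ)..s, G r.toNNReal ω := by
      funext s; rw [intervalIntegral.integral_of_le s.coe_nonneg]
    rw [heq]
    exact continuous_const.add (hprim.comp NNReal.continuous_coe)
  have hL : Continuous fun s : ℝ≥0 => F s ω := hωc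
  -- density argument
  have hdense : Dense (Set.range fun q : {q : ℚ // 0 ≤ (q : ℝ)} => Real.toNNReal (q : ℚ)) := by
    refine dense_iff_inter_open.2 fun U hU ⟨u, hu⟩ => ?_
    obtain ⟨ε, hε, hball⟩ := Metric.isOpen_iff.1 hU u hu
    obtain ⟨q, hq1, hq2⟩ := exists_rat_btwn (show (u : ℝ) < u + ε by linarith)
    have hq0 : 0 ≤ (q : ℝ) := u.coe_nonneg.trans hq1.le
    refine ⟨Real.toNNReal q, hball ?_, ⟨⟨q, hq0⟩, rfl⟩⟩
    rw [Metric.mem_ball, NNReal.dist_eq, Real.coe_toNNReal _ hq0, abs_sub_lt_iff]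
    constructor <;> linarith
  have heqOn : Set.EqOn (fun s : ℝ≥0 => F s ω) (fun s : ℝ≥0 => F 0 ω + ∫ r in Ioc (0 : ℝ) s, G r.toNNReal ω)
      (Set.range fun q : {q : ℚ // 0 ≤ (q : ℝ)} => Real.toNNReal (q : ℚ)) := by
    rintro _ ⟨⟨q, hq0⟩, rfl⟩
    exact hω q
  exact congrFun (Continuous.ext_on hdense hL hR heqOn) t

end Abstract

end Summit.QuantumFields.YangMills.Theorems.ColdStartUniversality

end
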